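import Summits.BirchSwinnertonDyer.BirchSwinnertonDyer.Theorems.RamifiedHeegnerPairLeafPartnerOrdersLocalRun
import Summits.BirchSwinnertonDyer.BirchSwinnertonDyer.Theorems.RamifiedHeegnerPairLeafPartnerOrdersEigenCharacter
import Mathlib.RingTheory.Adjoin.Basic
import Mathlib.LinearAlgebra.FreeModule.Finite.Matrix
import HarnessLib

/-!
# Route `RamifiedHeegnerPair`, crux U₁ `LeafRankOneUpperAtThree` (stmt-BirchSwinnertonDyer-26022), line `partnerdescent` —
# partner kernel, base change (α) part 1: the local run FROM GENERATORS — the Hecke algebra `A` is built inside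

HONEST FRAMING. Theorems only; helper file (`--supports stmt-BirchSwinnertonDyer-26022 --as helper`); pure commutative algebra composing
‹…LeafPartnerOrdersLocalRun› (p811638, `dvd_of_localRun`) and ‹…LeafPartnerOrdersEigenCharacter› (p811873); no number theory, no named fact,
no `sorry`; nothing booked; BSD is proved for no curve. Lead prover bsd-line-rhp-p2 g64, 2026-08-31.

WHY. `dvd_of_localRun` takes an ABSTRACT commutative finite free `R`-algebra `A` acting faithfully on `M`, a maximal ideal `𝔫`, an
eigencharacter `χ`, and hypotheses quantified over `A`. In the (α) base change (LEAD-G63-ASSEMBLY.md §4b) `A` is «the `ℤ₃`-subalgebra of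
`End M` generated by the chosen Hecke operators»; this file performs that construction ONCE, in Mathlib generality, so that the remaining
base-change work is stated over a mere SET `s ⊆ End_R M` of commuting endomorphisms (the `3`-adic Brandt ∕ `U` operators restricted to
`M = B̂`): `A := Algebra.adjoin R s` (commutative by `Algebra.isMulCommutative_adjoin`, finite free over the PID `R` as a torsion-free
submodule of `End_R M`, faithful tautologically), the eigencharacter `χ` of the common eigenvector `g` (`exists_eigencharacter`), `𝔫 := χ⁻¹(𝔪_R)`
(maximal: `χ` is onto), `u ∉ 𝔫 ⟺` the eigenvalue of `u` on `g` is a unit, and every `A`-quantified hypothesis of the run reduced to its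
generators or to `Algebra.adjoin R s` as a SET (invariance of the pairing: generators + commutativity; stability of `Y`: generators;
multiplicity one: cosets modulo the `R`-submodule `𝔪_R·M + Σ_{f ∈ s} (f − λ_f)·M`; (C5′) and the projector clauses: membership in
`Algebra.adjoin R s`). Main theorem `dvd_of_generatorsRun`: **`δ ∣ Rl`** from generator-level data. The pairing `β` need not be symmetric
(the caller uses Gross's pairing twisted by an Atkin–Lehner permutation, Mazur's device, so that the non-self-adjoint `U`-operators are allowed).
[cite: PapikianRabinoff2016, §3 ¶23–¶25, Lemma 24, Lemma 32] [cite: Mazur1977, II §15 (15.1) and Prop. 15.3 (the `w`-twisted pairing)]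
[cite: Matsumura1987, Thm. 2.3, Thm. 8.15]
-/

set_option linter.dupNamespace false
set_option autoImplicit false

noncomputable section

namespace Summit.BirchSwinnertonDyer.BirchSwinnertonDyer.Theorems.LeafPartnerOrders

open IsLocalRing Submodule

section Adjoin

variable {R : Type*} [CommRing R] {M : Type*} [AddCommGroup M] [Module R M]

/-- The action of an element of a subalgebra of `End_R M` on `M` is its action as an endomorphism. [folklore] -/
theorem adjoin_smul_def (s : Set (Module.End R M)) (a : Algebra.adjoin R s) (m : M) : a • m = (a : Module.End R M) m := rfl

/-- **Invariance of a pairing extends from commuting generators to the algebra they generate.** If `β(f x, y) = β(x, f y)` for every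
`f` in a set `s` of pairwise commuting endomorphisms, then the same holds for every element of `Algebra.adjoin R s` (products: use
commutativity inside the adjoined algebra). [folklore] -/
theorem pairing_invariant_of_generators {O : Type*} [CommRing O] [Module O M] [SMulCommClass R O M]
    (s : Set (Module.End R M)) (hcomm : ∀ a ∈ s, ∀ b ∈ s, a * b = b * a)
    (β : M →ₗ[O] M →ₗ[O] O) (hlinR : ∀ (r : R) (x y : M), β (r • x) y = β x (r • y))
    (hinv : ∀ f ∈ s, ∀ x y : M, β (f x) y = β x (f y))
    {a : Module.End R M} (ha : a ∈ Algebra.adjoin R s) : ∀ x y : M, β (a x) y = β x (a y) := by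
  induction ha using Algebra.adjoin_induction with
  | mem f hf => exact hinv f hf
  | algebraMap r =>
      intro x y
      rw [Module.algebraMap_end_apply, Module.algebraMap_end_apply, hlinR]
  | add f f' hf hf' ihf ihf' =>
      intro x y
      rw [LinearMap.add_apply, LinearMap.add_apply, map_add, LinearMap.add_apply, map_add, ihf, ihf']
  | mul f f' hf hf' ihf ihf' =>
      intro x y
      have hc : f * f' = f' * f :=
        congrArg Subtype.val ((Algebra.isMulCommutative_adjoin R hcomm).is_comm.comm ⟨f, hf⟩ ⟨f', hf'⟩)
      rw [Module.End.mul_apply, ihf, ihf', hc, Module.End.mul_apply]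

/-- **A common eigenvector of the generators is a common eigenvector of the adjoined algebra.** [folklore] -/
theorem exists_apply_eq_smul_of_generators (s : Set (Module.End R M)) {g : M}
    (hg : ∀ f ∈ s, ∃ c : R, f g = c • g) {a : Module.End R M} (ha : a ∈ Algebra.adjoin R s) : ∃ c : R, a g = c • g := by
  induction ha using Algebra.adjoin_induction with
  | mem f hf => exact hg f hf
  | algebraMap r => exact ⟨r, by rw [Module.algebraMap_end_apply]⟩
  | add f f' _ _ ihf ihf' =>
      obtain ⟨c, hc⟩ := ihf
      obtain ⟨c', hc'⟩ := ihf'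
      exact ⟨c + c', by rw [LinearMap.add_apply, hc, hc', add_smul]⟩
  | mul f f' _ _ ihf ihf' =>
      obtain ⟨c, hc⟩ := ihf
      obtain ⟨c', hc'⟩ := ihf'
      exact ⟨c * c', by rw [Module.End.mul_apply, hc', map_smul, hc, smul_smul, mul_comm]⟩

/-- **A submodule stable under the generators is stable under the adjoined algebra.** [folklore] -/
theorem apply_mem_of_generators (s : Set (Module.End R M)) (Y : Submodule R M)
    (hY : ∀ f ∈ s, ∀ y ∈ Y, f y ∈ Y) {a : Module.End R M} (ha : a ∈ Algebra.adjoin R s) : ∀ y ∈ Y, a y ∈ Y := by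
  induction ha using Algebra.adjoin_induction with
  | mem f hf => exact hY f hf
  | algebraMap r => intro y hy; rw [Module.algebraMap_end_apply]; exact Y.smul_mem r hy
  | add f f' _ _ ihf ihf' => intro y hy; rw [LinearMap.add_apply]; exact Y.add_mem (ihf y hy) (ihf' y hy)
  | mul f f' _ _ ihf ihf' => intro y hy; rw [Module.End.mul_apply]; exact ihf _ (ihf' y hy)

end Adjoin

section Run

variable {R : Type*} [CommRing R] [IsDomain R] [IsPrincipalIdealRing R] [IsLocalRing R]
  [IsAdicComplete (maximalIdeal R) R]
  {M : Type*} [AddCommGroup M] [Module R M] [Module.Finite R M]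

/-- **The local run from generators.** Data over a complete local PID `R` (`ℤ₃`): a finite `R`-torsion-free module `M`; a SET `s` of
pairwise commuting `R`-endomorphisms of `M` (the Hecke generators); an `R`-bilinear pairing `β`, invariant for each generator,
non-degenerate, exact-Eisenstein for an element `u ∈ R[s]`; a common eigenvector `g ≠ 0` of the generators (eigenvalues `λ_f`) on which `u`
acts by a UNIT `μ`; multiplicity one in cosocle form «`x − c·x₀ ∈ 𝔪_R·M + Σ_f (f − λ_f)·M` with `c ∈ R[s]`»; an `R`-submodule `Y` stable
under the generators, `N₀`-saturated, with a projector `u_Y ∈ R[s]` (`u_Y|_Y = N₀`, `u_Y M ⊆ Y`); an element `t ∈ R[s]` mapping `M` into the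
line `R·g`; `P : M → M`, `N ≠ 0`, `δ` with `δ·(t y) = N·P y` on `Y`; the lattice side «`Rl·(t y) ∈ N·Y`»; and (C5′) «`δ·(a y) = c·P y` on `Y` for
some `a ∈ R[s]` ⟹ `δ ∣ c`». CONCLUSION: `δ ∣ Rl`. Proof: `A := Algebra.adjoin R s` is commutative, finite free over `R`, faithful on `M`;
`χ` := the eigencharacter of `g` (‹EigenCharacter›), `𝔫 := χ⁻¹(𝔪_R)`; then `dvd_of_localRun` (‹LocalRun›).
[cite: PapikianRabinoff2016, §3 ¶23–¶25, Lemma 24, Lemma 32] [cite: Mazur1977, II Prop. 15.3] -/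
theorem dvd_of_generatorsRun
    (htf : ∀ (r : R) (m : M), r • m = 0 → r = 0 ∨ m = 0)
    (s : Set (Module.End R M)) (hcomm : ∀ a ∈ s, ∀ b ∈ s, a * b = b * a)
    (β : M →ₗ[R] M →ₗ[R] R) (hinv : ∀ f ∈ s, ∀ x y : M, β (f x) y = β x (f y))
    (hnd : ∀ x : M, (∀ y : M, β x y = 0) → x = 0)
    (u : Module.End R M) (hus : u ∈ Algebra.adjoin R s)
    (hEis : ∀ φ : Module.Dual R M, ∃ x : M, ∀ y : M, β x y = φ (u y))
    {g : M} (hg : g ≠ 0) (lam : Module.End R M → R) (hlam : ∀ f ∈ s, f g = lam f • g)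
    (μ : R) (huμ : u g = μ • g) (hμ : μ ∉ maximalIdeal R)
    (x₀ : M) (hmult : ∀ x : M, ∃ c ∈ Algebra.adjoin R s,
      x - c x₀ ∈ maximalIdeal R • (⊤ : Submodule R M) ⊔ ⨆ f ∈ s, LinearMap.range (f - lam f • (1 : Module.End R M)))
    (Y : Submodule R M) (hYs : ∀ f ∈ s, ∀ y ∈ Y, f y ∈ Y)
    (uY : Module.End R M) (huYs : uY ∈ Algebra.adjoin R s) (N₀ : R) (huY : ∀ y ∈ Y, uY y = N₀ • y) (huYM : ∀ m : M, uY m ∈ Y)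
    (hsat : ∀ m : M, N₀ • m ∈ Y → m ∈ Y)
    (t : Module.End R M) (hts : t ∈ Algebra.adjoin R s) (ht : ∀ x : M, ∃ c : R, t x = c • g)
    (P : M → M) (N δ : R) (hN : N ≠ 0) (hP : ∀ y ∈ Y, δ • t y = N • P y)
    (Rl : R) (hlat : ∀ y ∈ Y, ∃ y' ∈ Y, Rl • t y = N • y')
    (hC5 : ∀ a ∈ Algebra.adjoin R s, ∀ c : R, (∀ y ∈ Y, δ • a y = c • P y) → δ ∣ c) :
    δ ∣ Rl := by
  classical
  -- the algebra `A` and its structure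
  set A : Subalgebra R (Module.End R M) := Algebra.adjoin R s with hAdef
  haveI hAc : IsMulCommutative A := Algebra.isMulCommutative_adjoin R hcomm
  letI : CommRing A := { (inferInstance : Ring A) with mul_comm := fun a b ↦ hAc.is_comm.comm a b }
  haveI : Module.IsTorsionFree R M := Module.IsTorsionFree.of_smul_eq_zero htf
  haveI : Module.Free R M := Module.free_of_finite_type_torsion_free'
  haveI : IsNoetherianRing R := inferInstance
  haveI : IsNoetherian R (Module.End R M) := isNoetherian_of_isNoetherianRing_of_finite R _
  haveI : Module.Finite R A := Module.Finite.of_injective A.val.toLinearMap Subtype.val_injective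
  haveI : Module.IsTorsionFree R A := by
    refine Module.IsTorsionFree.of_smul_eq_zero fun r a hra ↦ ?_
    by_cases hr : r = 0
    · exact Or.inl hr
    · right
      apply Subtype.ext
      ext m
      have h1 : (r • (a : Module.End R M)) m = 0 := by
        have := congrArg Subtype.val hra
        rw [Subalgebra.coe_smul] at this
        rw [this]; rfl
      rw [LinearMap.smul_apply] at h1
      rcases htf r _ h1 with h | h
      · exact absurd h hr
      · rw [h]; rfl
  haveI : Module.Free R A := Module.free_of_finite_type_torsion_free'
  -- faithfulness (tautological)
  have hfaith : ∀ a : A, (∀ m : M, a • m = 0) → a = 0 := fun a ha ↦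
    Subtype.ext (LinearMap.ext fun m ↦ ha m)
  -- the eigencharacter of `g`
  have hline : ∀ a : A, ∃ c : R, a • g = c • g := fun a ↦
    exists_apply_eq_smul_of_generators s (fun f hf ↦ ⟨lam f, hlam f hf⟩) a.2
  obtain ⟨χ, hχ⟩ := exists_eigencharacter (A := A) htf hg hline
  -- uniqueness of eigenvalues on `g`
  have huniq : ∀ c c' : R, c • g = c' • g → c = c' := by
    intro c c' h
    have h0 : (c - c') • g = 0 := by rw [sub_smul, h, sub_self]
    rcases htf _ _ h0 with h1 | h1
    · exact sub_eq_zero.mp h1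
    · exact absurd h1 hg
  have hχval : ∀ (a : Module.End R M) (ha : a ∈ A) (c : R), a g = c • g → χ ⟨a, ha⟩ = c := by
    intro a ha c hac
    apply huniq
    rw [← hχ ⟨a, ha⟩]
    exact hac
  -- the maximal ideal `𝔫 = χ⁻¹(𝔪_R)`
  set 𝔫 : Ideal A := (maximalIdeal R).comap χ with h𝔫def
  have hχsurj : Function.Surjective χ := fun r ↦ ⟨algebraMap R A r, by rw [AlgHom.commutes]; rfl⟩
  haveI : 𝔫.IsMaximal := Ideal.comap_isMaximal_of_surjective χ hχsurj
  have h𝔫 : ∀ a : A, a ∈ 𝔫 ↔ χ a ∈ maximalIdeal R := fun a ↦ Ideal.mem_comap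
  -- `u ∉ 𝔫`
  have hu : (⟨u, hus⟩ : A) ∉ 𝔫 := by
    rw [h𝔫, hχval u hus μ huμ]
    exact hμ
  -- invariance of `β` for all of `A`
  have hinvA : ∀ (a : A) (x y : M), β (a • x) y = β x (a • y) := by
    intro a x y
    rw [adjoin_smul_def, adjoin_smul_def]
    exact pairing_invariant_of_generators s hcomm β (fun r x y ↦ by rw [map_smul, LinearMap.smul_apply, map_smul, smul_eq_mul])
      hinv a.2 x y
  -- exact Eisenstein with `u ∈ A`
  have hEisA : ∀ φ : Module.Dual R M, ∃ x : M, ∀ y : M, β x y = φ ((⟨u, hus⟩ : A) • y) := hEis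
  -- multiplicity one over `A`
  have hmultA : ∀ x : M, ∃ c : A, x - c • x₀ ∈ 𝔫 • (⊤ : Submodule A M) := by
    intro x
    obtain ⟨c, hc, hx⟩ := hmult x
    refine ⟨⟨c, hc⟩, ?_⟩
    rw [adjoin_smul_def]
    -- the `R`-submodule `𝔪_R·M + Σ_f (f − λ_f)·M` is contained in `𝔫·M`
    let N' : Submodule R M := (𝔫 • (⊤ : Submodule A M)).restrictScalars R
    have hN' : ∀ z : M, z ∈ N' ↔ z ∈ 𝔫 • (⊤ : Submodule A M) := fun z ↦ Iff.rfl
    have hle1 : maximalIdeal R • (⊤ : Submodule R M) ≤ N' := by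
      refine Submodule.smul_le.mpr fun r hr m _ ↦ ?_
      rw [hN']
      have hmem : algebraMap R A r ∈ 𝔫 := by rw [h𝔫, AlgHom.commutes]; exact hr
      have : r • m = (algebraMap R A r) • m := (algebraMap_smul A r m).symm
      rw [this]
      exact Submodule.smul_mem_smul hmem Submodule.mem_top
    have hle2 : (⨆ f ∈ s, LinearMap.range (f - lam f • (1 : Module.End R M))) ≤ N' := by
      refine iSup₂_le fun f hf ↦ ?_
      rintro _ ⟨m, rfl⟩
      rw [hN']
      have hfs : f - lam f • (1 : Module.End R M) ∈ A :=
        Subalgebra.sub_mem _ (Algebra.subset_adjoin hf) (Subalgebra.smul_mem _ (Subalgebra.one_mem _) _)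
      have hmem : (⟨f - lam f • (1 : Module.End R M), hfs⟩ : A) ∈ 𝔫 := by
        rw [h𝔫, hχval _ hfs 0 ?_]
        · exact Ideal.zero_mem _
        · rw [LinearMap.sub_apply, LinearMap.smul_apply, Module.End.one_apply, hlam f hf, sub_self, zero_smul]
      have : (f - lam f • (1 : Module.End R M)) m = (⟨f - lam f • 1, hfs⟩ : A) • m := rfl
      rw [this]
      exact Submodule.smul_mem_smul hmem Submodule.mem_top
    have hle : maximalIdeal R • (⊤ : Submodule R M) ⊔
        (⨆ f ∈ s, LinearMap.range (f - lam f • (1 : Module.End R M))) ≤ N' := sup_le hle1 hle2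
    exact (hN' _).mp (hle hx)
  -- `Y` as an `A`-submodule
  let YA : Submodule A M :=
    { carrier := Y
      add_mem' := fun {a b} ha hb ↦ Y.add_mem ha hb
      zero_mem' := Y.zero_mem
      smul_mem' := fun c {y} hy ↦ apply_mem_of_generators s Y hYs c.2 y hy }
  have hYA : ∀ y : M, y ∈ YA ↔ y ∈ Y := fun y ↦ Iff.rfl
  -- the eigen-element `t`
  have hχt : ∀ a : A, a * ⟨t, hts⟩ = χ a • (⟨t, hts⟩ : A) := by
    intro a
    exact mul_eq_smul_of_range_le_line (A := A) hfaith χ hχ (t := ⟨t, hts⟩) ht a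
  -- run
  refine dvd_of_localRun (A := A) htf hfaith β hinvA hnd ⟨u, hus⟩ hEisA 𝔫 hu x₀ hmultA YA ⟨uY, huYs⟩ N₀
    (fun y hy ↦ huY y ((hYA y).mp hy)) (fun m ↦ (hYA _).mpr (huYM m)) (fun m hm ↦ (hYA m).mpr (hsat m ((hYA _).mp hm)))
    χ ⟨t, hts⟩ hχt h𝔫 P N δ hN (fun y hy ↦ hP y ((hYA y).mp hy)) Rl
    (fun y hy ↦ ?_) (fun a c hac ↦ hC5 a a.2 c fun y hy ↦ hac y ((hYA y).mpr hy))
  obtain ⟨y', hy', h⟩ := hlat y ((hYA y).mp hy)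
  exact ⟨y', (hYA y').mpr hy', h⟩

end Run

end Summit.BirchSwinnertonDyer.BirchSwinnertonDyer.Theorems.LeafPartnerOrders

end
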